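import Mathlib
import HarnessLib
import Summits.HubbardSuperconductivity.HubbardSuperconductivity.Theorems.KLProgrammeBareVertexCutCurrency
import Summits.HubbardSuperconductivity.HubbardSuperconductivity.Theorems.KLProgrammeLocalVertexMonomialExpansion

/-!
# Route `KLProgramme` — ENGINE (stmt-HubbardSuperconductivity-20437 `KLRegimeEngineV17F2`), located #25 «(b)-PLAIN-UV-TAIL», cure (α),
# E1 item (i): THE ONE-LEG FACTORISATION `Θ^cut ≤ A⁴` of the plain pinned currency of a frequency-weighted bare vertex
# (cell gate-hubbard-kl, seat hubbard-kl-k3c2-p2 g35; companion of ✓ p765343 / ✓ p773994)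

✓ p773994 (`…BareVertexCutCurrency`) proved the exact identity `ε³Σ_{x′: x′_q = y}‖W₄(S_ĝ V)(x′)‖ = (|U|/24)·Θ^cut_M(β)` with
`Θ^cut = (2M)⁻³Σ_{t : t_q = y₀}|Σ_{n : n₀+n₂ = n₁+n₃ in ℤ}(∏ĝ(ω_{n_i}))∏e^{−is_iω_{n_i}τ_{t_i}}|`.  This file proves the finite-sum inequality behind the
β- and `M`-uniformity of that currency ([float] `Θ^cut ≈ 2.72 ≤ A⁴ ≈ 3.56`, HOME/hubbard-kl-k3c2-p2/g34/CUT-CURRENCY-DIGITS.md rev 2):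
for ANY leg weight `c` supported away from the Matsubara edge (`4|n| < 2M` on `supp c`),

  `(2M)⁻³ Σ_{t : t_q = y₀} |Σ_{n allowed} (∏ c(n_i)) ∏ e^{−is_iω_{n_i}τ_{t_i}}| ≤ A(c)⁴`,  `A(c) := (2M)⁻¹ Σ_{j ∈ ℤ_{2M}} |Σ_{v ∈ ℤ_{2M}} c(v) e^{−2πi v j/(2M)}|`

(`klct_pinnedTimeSum_le_legMass_pow_four`): on the support, integer conservation = conservation MODULO `2M` = `(2M)⁻¹Σ_σ e^{−2πi(n₀−n₁+n₂−n₃)σ/2M}`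
(`klbv_sum_cexp_two_pi_int`), the quadruple sum factorises over the legs at a common auxiliary time `σ`, each leg factor has modulus
`|ĉ(±(t_i+σ))|`, and the pinned sum of the product is `|ĉ(±(y₀+σ))|·(Σ_j|ĉ(j)|)³`.  Corollary `klbv_plainCurrency_uvCut_hubbardInteraction_le_legMass_pow_four`:
the cut vertex's plain pinned currency is `≤ (|U|/24)·A(ĝ∘ω)⁴` as soon as `2 ≤ β ≤ M`.  The β/M-free bound on `A(ĝ∘ω)` (two discrete summations by
parts) is the sequel file.  Pure finite-sum algebra; no definition; nothing asserts any row, (b), (C), K3, U₀, the window or superconductivity.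
References: BGM 2006 §2.1 (2.5)–(2.6a), §2.3 (2.17) [cite: BenfattoGiulianiMastropietro2006]; Salmhofer 1999 §4.2.4 [cite: Salmhofer1999].
-/

noncomputable section

namespace Summit.HubbardSuperconductivity.HubbardSuperconductivity.Theorems.KLRegimeSplit

set_option linter.dupNamespace false -- summit = problem name (single-conjunct summit), D-0017

open Finset Literature.MathematicalPhysics.QuantumLattice Literature.Probability.LatticeModels GrassmannAlgebra
open scoped ComplexConjugate

variable {L M : ℕ} [NeZero M]

/-! ## §1 Arithmetic of the cyclic time group `ℤ_{2M}` -/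

omit [NeZero M] in
/-- `val (x + y) ≡ val x + val y (mod 2M)`. -/
theorem klct_val_add_modEq (x y : ImagTimeIdx M) :
    ((((x + y : ImagTimeIdx M) : ℕ) : ℤ)) ≡ ((x : ℕ) : ℤ) + ((y : ℕ) : ℤ) [ZMOD ((2 * M : ℕ) : ℤ)] := by
  rw [Fin.val_add, Int.natCast_mod]
  push_cast
  exact Int.mod_modEq _ _

omit [NeZero M] in
/-- `val (−x) ≡ −val x (mod 2M)`. -/
theorem klct_val_neg_modEq (x : ImagTimeIdx M) :
    ((((-x : ImagTimeIdx M) : ℕ) : ℤ)) ≡ -(((x : ℕ) : ℤ)) [ZMOD ((2 * M : ℕ) : ℤ)] := by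
  rw [Fin.val_neg', Int.natCast_mod, Nat.cast_sub x.isLt.le]
  refine (Int.mod_modEq _ _).trans ?_
  rw [Int.modEq_iff_dvd]
  exact ⟨-1, by push_cast; ring⟩

/-- **Periodicity of the leg phase**: `e^{−2πi v b/(2M)}` depends on `b` only modulo `2M` (`v ∈ ℕ`). -/
theorem klct_cexp_periodic (v : ℕ) {b b' : ℤ} (h : b ≡ b' [ZMOD ((2 * M : ℕ) : ℤ)]) :
    Complex.exp (-((2 * Real.pi * (v : ℝ) * (b : ℝ) / (2 * M) : ℝ) : ℂ) * Complex.I) =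
      Complex.exp (-((2 * Real.pi * (v : ℝ) * (b' : ℝ) / (2 * M) : ℝ) : ℂ) * Complex.I) := by
  obtain ⟨k, hk⟩ := (Int.modEq_iff_dvd.mp h)
  have hM : (M : ℝ) ≠ 0 := by exact_mod_cast NeZero.ne M
  have hb' : (b' : ℝ) = (b : ℝ) + ((2 * M : ℕ) : ℝ) * (k : ℝ) := by
    have : b' = b + ((2 * M : ℕ) : ℤ) * k := by linarith
    rw [this]; push_cast; ring
  have hreal : (2 * Real.pi * (v : ℝ) * (b' : ℝ) / (2 * M) : ℝ) = 2 * Real.pi * (v : ℝ) * (b : ℝ) / (2 * M) + (v : ℝ) * (k : ℝ) * (2 * Real.pi) := by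
    rw [hb']; push_cast; field_simp
  have hsplit : (-((2 * Real.pi * (v : ℝ) * (b' : ℝ) / (2 * M) : ℝ) : ℂ) * Complex.I) =
      (-((2 * Real.pi * (v : ℝ) * (b : ℝ) / (2 * M) : ℝ) : ℂ) * Complex.I) + ((-((v : ℤ) * k) : ℤ) : ℂ) * (2 * Real.pi * Complex.I) := by
    rw [hreal]; push_cast; ring
  rw [hsplit, Complex.exp_add, Complex.exp_int_mul_two_pi_mul_I, mul_one]

/-- Unimodularity of the phases `e^{−ix}`, `x ∈ ℝ`. -/
theorem klct_norm_cexp_neg_real_mul_I (x : ℝ) : ‖Complex.exp (-(x : ℂ) * Complex.I)‖ = 1 := by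
  have h : (-(x : ℂ) * Complex.I) = (((-x : ℝ) : ℂ) * Complex.I) := by push_cast; ring
  rw [h, Complex.norm_exp_ofReal_mul_I]

/-! ## §2 One leg at a common auxiliary time: modulus = the leg transform at `±(t+σ)` -/

/-- **The leg factor's modulus.**  For a charge index `e` (sign `s = chargeSign e = ±1`), a time `u`, an auxiliary time `σ` and `β ≠ 0`,
`|Σ_n c(n) e^{−is ω_n τ_u} e^{−2πi s n' σ/(2M)}| = |Σ_n c(n) e^{−2πi n w/(2M)}|` with `w = u + σ` (`s = 1`) resp. `w = −(u+σ)` (`s = −1`) in `ℤ_{2M}`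
(`n' = matsubaraInt n = n − M`; the `n`-independent phases drop out of the modulus, the rest is `2M`-periodic). -/
theorem klct_leg_norm_eq {β : ℝ} (hβ : β ≠ 0) (c : MatsubaraIdx M → ℂ) (e : Fin 2) (u σ : ImagTimeIdx M) :
    ‖∑ n : MatsubaraIdx M, c n * Complex.exp (-((chargeSign e * (matsubaraFreq β M n * imagTime β M u) : ℝ) : ℂ) * Complex.I) *
        Complex.exp (-((2 * Real.pi * chargeSign e * (matsubaraInt M n : ℝ) * ((σ : ℕ) : ℝ) / (2 * M) : ℝ) : ℂ) * Complex.I)‖ =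
      ‖∑ n : MatsubaraIdx M, c n *
          Complex.exp (-((2 * Real.pi * ((n : ℕ) : ℝ) * ((((if e = 0 then u + σ else -(u + σ) : ImagTimeIdx M)) : ℕ) : ℝ) / (2 * M) : ℝ) : ℂ) * Complex.I)‖ := by
  have hM : (M : ℝ) ≠ 0 := by exact_mod_cast NeZero.ne M
  set s : ℝ := chargeSign e with hsdef
  set a : ℕ := (u : ℕ) + (σ : ℕ) with hadef
  -- the `n`-independent phase
  set Ψ : ℝ := s * Real.pi * ((u : ℕ) : ℝ) / (2 * M) - Real.pi * s * (a : ℝ) with hΨdef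
  have hsummand : ∀ n : MatsubaraIdx M,
      c n * Complex.exp (-((s * (matsubaraFreq β M n * imagTime β M u) : ℝ) : ℂ) * Complex.I) *
          Complex.exp (-((2 * Real.pi * s * (matsubaraInt M n : ℝ) * ((σ : ℕ) : ℝ) / (2 * M) : ℝ) : ℂ) * Complex.I) =
        (c n * Complex.exp (-((2 * Real.pi * ((n : ℕ) : ℝ) * ((s * (a : ℝ) : ℝ)) / (2 * M) : ℝ) : ℂ) * Complex.I)) *
          Complex.exp (-(Ψ : ℂ) * Complex.I) := by
    intro n
    rw [mul_assoc (c n), ← Complex.exp_add, mul_assoc (c n), ← Complex.exp_add]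
    refine congrArg (fun z => c n * Complex.exp z) ?_
    have hre : s * (matsubaraFreq β M n * imagTime β M u) + 2 * Real.pi * s * (matsubaraInt M n : ℝ) * ((σ : ℕ) : ℝ) / (2 * M) =
        2 * Real.pi * ((n : ℕ) : ℝ) * ((s * (a : ℝ) : ℝ)) / (2 * M) + Ψ := by
      simp only [matsubaraFreq, imagTime, matsubaraInt, hΨdef, hadef]
      push_cast
      field_simp
      ring
    calc (-((s * (matsubaraFreq β M n * imagTime β M u) : ℝ) : ℂ) * Complex.I +
            -((2 * Real.pi * s * (matsubaraInt M n : ℝ) * ((σ : ℕ) : ℝ) / (2 * M) : ℝ) : ℂ) * Complex.I)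
          = -(((s * (matsubaraFreq β M n * imagTime β M u) + 2 * Real.pi * s * (matsubaraInt M n : ℝ) * ((σ : ℕ) : ℝ) / (2 * M) : ℝ)) : ℂ) * Complex.I := by
            push_cast; ring
      _ = _ := by rw [hre]; push_cast; ring
  rw [Finset.sum_congr rfl (fun n _ => hsummand n), ← Finset.sum_mul, norm_mul, klct_norm_cexp_neg_real_mul_I, mul_one]
  -- periodicity: `s·a ≡ val w (mod 2M)`
  congr 1
  refine Finset.sum_congr rfl (fun n _ => ?_)
  congr 1
  by_cases he : e = 0
  · have hs : s = 1 := by simp [hsdef, chargeSign, he]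
    rw [if_pos he, hs, one_mul]
    have h1 : ((a : ℝ)) = (((a : ℕ) : ℤ) : ℝ) := by push_cast; rfl
    have h2 : ((((u + σ : ImagTimeIdx M)) : ℕ) : ℝ) = (((((u + σ : ImagTimeIdx M)) : ℕ) : ℤ) : ℝ) := by push_cast; rfl
    rw [h1, h2]
    exact klct_cexp_periodic (n : ℕ) ((klct_val_add_modEq u σ).symm.trans (by rfl))
  · have hs : s = -1 := by simp [hsdef, chargeSign, he]
    rw [if_neg he, hs]
    have h1 : ((-1 * (a : ℝ) : ℝ)) = (((-((a : ℕ) : ℤ)) : ℤ) : ℝ) := by push_cast; ring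
    have h2 : ((((-(u + σ) : ImagTimeIdx M)) : ℕ) : ℝ) = (((((-(u + σ) : ImagTimeIdx M)) : ℕ) : ℤ) : ℝ) := by push_cast; rfl
    rw [h1, h2]
    refine klct_cexp_periodic (n : ℕ) ?_
    have hneg := klct_val_neg_modEq (u + σ : ImagTimeIdx M)
    have hadd := (klct_val_add_modEq u σ).neg
    exact (hneg.trans hadd).symm

/-- **Summing the leg modulus over the leg's own time gives the full leg mass** (the shift/reflection `u ↦ ±(u+σ)` is a bijection of `ℤ_{2M}`). -/
theorem klct_sum_leg_norm_time {β : ℝ} (hβ : β ≠ 0) (c : MatsubaraIdx M → ℂ) (e : Fin 2) (σ : ImagTimeIdx M) :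
    ∑ u : ImagTimeIdx M, ‖∑ n : MatsubaraIdx M, c n * Complex.exp (-((chargeSign e * (matsubaraFreq β M n * imagTime β M u) : ℝ) : ℂ) * Complex.I) *
        Complex.exp (-((2 * Real.pi * chargeSign e * (matsubaraInt M n : ℝ) * ((σ : ℕ) : ℝ) / (2 * M) : ℝ) : ℂ) * Complex.I)‖ =
      ∑ j : ImagTimeIdx M, ‖∑ n : MatsubaraIdx M, c n * Complex.exp (-((2 * Real.pi * ((n : ℕ) : ℝ) * ((j : ℕ) : ℝ) / (2 * M) : ℝ) : ℂ) * Complex.I)‖ := by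
  simp_rw [klct_leg_norm_eq hβ]
  by_cases he : e = 0
  · simp only [he, if_true]
    exact Fintype.sum_bijective (fun u : ImagTimeIdx M => u + σ) (Equiv.addRight σ).bijective _ _ (fun _ => rfl)
  · simp only [he, if_false]
    exact Fintype.sum_bijective (fun u : ImagTimeIdx M => -(u + σ)) ((Equiv.addRight σ).trans (Equiv.neg _)).bijective _ _ (fun _ => rfl)

/-- **Summing the pinned leg's modulus over the auxiliary time gives the full leg mass** (`σ ↦ ±(y₀+σ)` is a bijection of `ℤ_{2M}`). -/
theorem klct_sum_leg_norm_aux {β : ℝ} (hβ : β ≠ 0) (c : MatsubaraIdx M → ℂ) (e : Fin 2) (y₀ : ImagTimeIdx M) :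
    ∑ σ : ImagTimeIdx M, ‖∑ n : MatsubaraIdx M, c n * Complex.exp (-((chargeSign e * (matsubaraFreq β M n * imagTime β M y₀) : ℝ) : ℂ) * Complex.I) *
        Complex.exp (-((2 * Real.pi * chargeSign e * (matsubaraInt M n : ℝ) * ((σ : ℕ) : ℝ) / (2 * M) : ℝ) : ℂ) * Complex.I)‖ =
      ∑ j : ImagTimeIdx M, ‖∑ n : MatsubaraIdx M, c n * Complex.exp (-((2 * Real.pi * ((n : ℕ) : ℝ) * ((j : ℕ) : ℝ) / (2 * M) : ℝ) : ℂ) * Complex.I)‖ := by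
  simp_rw [klct_leg_norm_eq hβ]
  by_cases he : e = 0
  · simp only [he, if_true]
    exact Fintype.sum_bijective (fun σ : ImagTimeIdx M => y₀ + σ) (Equiv.addLeft y₀).bijective _ _ (fun _ => rfl)
  · simp only [he, if_false]
    exact Fintype.sum_bijective (fun σ : ImagTimeIdx M => -(y₀ + σ)) ((Equiv.addLeft y₀).trans (Equiv.neg _)).bijective _ _ (fun _ => rfl)

/-! ## §3 Pinned sums of products -/

omit [NeZero M] in
/-- **A pinned sum of a product of one-leg functions**: `Σ_{t : t_q = y₀} ∏_i F_i(t_i) = F_q(y₀) · ∏_{i ≠ q} Σ_u F_i(u)`. -/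
theorem klct_sum_pinned_prod (F : Fin 4 → ImagTimeIdx M → ℝ) (q : Fin 4) (y₀ : ImagTimeIdx M) :
    ∑ t ∈ univ.filter (fun t : Fin 4 → ImagTimeIdx M => t q = y₀), ∏ i : Fin 4, F i (t i) =
      F q y₀ * ∏ i ∈ univ.erase q, ∑ u : ImagTimeIdx M, F i u := by
  classical
  -- push the pin into the `q`-th factor
  set F' : Fin 4 → ImagTimeIdx M → ℝ := fun i u => if i = q then (if u = y₀ then F i u else 0) else F i u with hF'
  have hpt : ∀ t : Fin 4 → ImagTimeIdx M, (if t q = y₀ then ∏ i : Fin 4, F i (t i) else 0) = ∏ i : Fin 4, F' i (t i) := by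
    intro t
    by_cases ht : t q = y₀
    · rw [if_pos ht]
      refine Finset.prod_congr rfl (fun i _ => ?_)
      by_cases hi : i = q
      · subst hi; simp [hF', ht]
      · simp [hF', hi]
    · rw [if_neg ht]
      symm
      exact Finset.prod_eq_zero (Finset.mem_univ q) (by simp [hF', ht])
  rw [Finset.sum_filter, Finset.sum_congr rfl (fun t _ => hpt t), ← Fintype.prod_sum F', ← Finset.mul_prod_erase univ _ (Finset.mem_univ q)]
  congr 1
  · simp only [hF', if_true]
    rw [Finset.sum_ite_eq' univ y₀, if_pos (Finset.mem_univ _)]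
  · refine Finset.prod_congr rfl (fun i hi => ?_)
    have hiq : i ≠ q := Finset.ne_of_mem_erase hi
    simp [hF', hiq]

/-! ## §4 The conserving quadruple sum at one time tuple: modular delta and factorisation over the legs -/

/-- The vertex pattern's charge indices are `(0, 1, 0, 1)`, i.e. signs `(+, −, +, −)`. -/
theorem klct_pattern_charge (i : Fin 4) :
    ((![(((0 : Fin 1), (0 : Fin 2)), (0 : Fin 2)), ((0, 0), 1), ((0, 1), 0), ((0, 1), 1)] : Fin 4 → SectorLeg 1) i).2 = ![0, 1, 0, 1] i := by
  fin_cases i <;> rfl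

omit [NeZero M] in
/-- The signed Matsubara sum of a quadruple IS the pattern's signed sum: `Σ_i s_i n'_i = n'₀ − n'₁ + n'₂ − n'₃`. -/
theorem klct_signedSum_eq (n : Fin 4 → MatsubaraIdx M) :
    ∑ i : Fin 4, chargeSign (![(0 : Fin 2), 1, 0, 1] i) * (matsubaraInt M (n i) : ℝ) =
      ((matsubaraInt M (n 0) - matsubaraInt M (n 1) + matsubaraInt M (n 2) - matsubaraInt M (n 3) : ℤ) : ℝ) := by
  rw [Fin.sum_univ_four]
  simp only [Matrix.cons_val_zero, Matrix.cons_val_one, Matrix.cons_val, chargeSign, if_true, show (1 : Fin 2) ≠ 0 by decide, if_false]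
  push_cast
  ring

/-- **Modular delta ⇒ factorisation.**  For a leg weight `c` supported in `4|n'| < 2M`, at every time tuple `t`,
`Σ_{n : n'₀+n'₂ = n'₁+n'₃} (∏ c(n_i)) ∏ e^{−is_iω_{n_i}τ_{t_i}} = (2M)⁻¹ Σ_σ ∏_i G_i(t_i, σ)`,
`G_i(u,σ) = Σ_n c(n) e^{−is_iω_nτ_u} e^{−2πi s_i n' σ/(2M)}`. -/
theorem klct_timeSum_eq_aux_sum (β : ℝ) (c : MatsubaraIdx M → ℂ) (hc : ∀ n : MatsubaraIdx M, c n ≠ 0 → (4 : ℤ) * |matsubaraInt M n| < 2 * M)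
    (t : Fin 4 → ImagTimeIdx M) :
    (∑ n : Fin 4 → MatsubaraIdx M,
        if matsubaraInt M (n 0) + matsubaraInt M (n 2) = matsubaraInt M (n 1) + matsubaraInt M (n 3) then
          (∏ i : Fin 4, c (n i)) * ∏ i : Fin 4, Complex.exp (-((chargeSign ((![(((0 : Fin 1), (0 : Fin 2)), (0 : Fin 2)), ((0, 0), 1), ((0, 1), 0), ((0, 1), 1)] : Fin 4 → SectorLeg 1) i).2 * (matsubaraFreq β M (n i) * imagTime β M (t i)) : ℝ) : ℂ) * Complex.I)
        else 0) =
      (((2 * M : ℕ) : ℂ))⁻¹ * ∑ σ : ImagTimeIdx M, ∏ i : Fin 4,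
        ∑ v : MatsubaraIdx M, c v * Complex.exp (-((chargeSign (![(0 : Fin 2), 1, 0, 1] i) * (matsubaraFreq β M v * imagTime β M (t i)) : ℝ) : ℂ) * Complex.I) *
          Complex.exp (-((2 * Real.pi * chargeSign (![(0 : Fin 2), 1, 0, 1] i) * (matsubaraInt M v : ℝ) * ((σ : ℕ) : ℝ) / (2 * M) : ℝ) : ℂ) * Complex.I) := by
  have hN : ((2 * M : ℕ) : ℂ) ≠ 0 := by have := NeZero.ne M; exact_mod_cast (by omega : 2 * M ≠ 0)
  simp_rw [klct_pattern_charge]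
  -- factorise the product over legs back into a sum over quadruples
  have hfact : ∀ σ : ImagTimeIdx M, (∏ i : Fin 4,
        ∑ v : MatsubaraIdx M, c v * Complex.exp (-((chargeSign (![(0 : Fin 2), 1, 0, 1] i) * (matsubaraFreq β M v * imagTime β M (t i)) : ℝ) : ℂ) * Complex.I) *
          Complex.exp (-((2 * Real.pi * chargeSign (![(0 : Fin 2), 1, 0, 1] i) * (matsubaraInt M v : ℝ) * ((σ : ℕ) : ℝ) / (2 * M) : ℝ) : ℂ) * Complex.I)) =
      ∑ n : Fin 4 → MatsubaraIdx M, ∏ i : Fin 4,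
        c (n i) * Complex.exp (-((chargeSign (![(0 : Fin 2), 1, 0, 1] i) * (matsubaraFreq β M (n i) * imagTime β M (t i)) : ℝ) : ℂ) * Complex.I) *
          Complex.exp (-((2 * Real.pi * chargeSign (![(0 : Fin 2), 1, 0, 1] i) * (matsubaraInt M (n i) : ℝ) * ((σ : ℕ) : ℝ) / (2 * M) : ℝ) : ℂ) * Complex.I) :=
    fun σ => Fintype.prod_sum (fun (i : Fin 4) (v : MatsubaraIdx M) =>
      c v * Complex.exp (-((chargeSign (![(0 : Fin 2), 1, 0, 1] i) * (matsubaraFreq β M v * imagTime β M (t i)) : ℝ) : ℂ) * Complex.I) *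
          Complex.exp (-((2 * Real.pi * chargeSign (![(0 : Fin 2), 1, 0, 1] i) * (matsubaraInt M v : ℝ) * ((σ : ℕ) : ℝ) / (2 * M) : ℝ) : ℂ) * Complex.I))
  simp_rw [hfact]
  rw [Finset.sum_comm, Finset.mul_sum]
  refine Finset.sum_congr rfl (fun n _ => ?_)
  -- the signed integer of the quadruple
  set m : ℤ := matsubaraInt M (n 0) - matsubaraInt M (n 1) + matsubaraInt M (n 2) - matsubaraInt M (n 3) with hmdef
  set P : ℂ := (∏ i : Fin 4, c (n i)) *
      ∏ i : Fin 4, Complex.exp (-((chargeSign (![(0 : Fin 2), 1, 0, 1] i) * (matsubaraFreq β M (n i) * imagTime β M (t i)) : ℝ) : ℂ) * Complex.I) with hPdef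
  -- each σ-summand is the modular character at `m` times `P`
  have hσ : ∀ σ : ImagTimeIdx M, (∏ i : Fin 4,
        c (n i) * Complex.exp (-((chargeSign (![(0 : Fin 2), 1, 0, 1] i) * (matsubaraFreq β M (n i) * imagTime β M (t i)) : ℝ) : ℂ) * Complex.I) *
          Complex.exp (-((2 * Real.pi * chargeSign (![(0 : Fin 2), 1, 0, 1] i) * (matsubaraInt M (n i) : ℝ) * ((σ : ℕ) : ℝ) / (2 * M) : ℝ) : ℂ) * Complex.I)) =
      Complex.exp (-((2 * Real.pi * (m : ℝ) * ((σ : ℕ) : ℝ) / (2 * M) : ℝ) : ℂ) * Complex.I) * P := by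
    intro σ
    rw [prod_mul_distrib, prod_mul_distrib, hPdef, mul_comm]
    congr 1
    rw [← Complex.exp_sum]
    congr 1
    have hre : (∑ i : Fin 4, (2 * Real.pi * chargeSign (![(0 : Fin 2), 1, 0, 1] i) * (matsubaraInt M (n i) : ℝ) * ((σ : ℕ) : ℝ) / (2 * M) : ℝ)) =
        2 * Real.pi * (m : ℝ) * ((σ : ℕ) : ℝ) / (2 * M) := by
      rw [hmdef, ← klct_signedSum_eq, Finset.mul_sum, Finset.sum_mul, Finset.sum_div]
      refine Finset.sum_congr rfl (fun i _ => ?_)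
      ring
    rw [← hre]
    push_cast
    rw [← Finset.sum_mul, ← Finset.sum_neg_distrib]
  simp_rw [hσ]
  rw [← Finset.sum_mul, klbv_sum_cexp_two_pi_int m]
  -- case analysis: is `P = 0` (some weight vanishes)?
  by_cases hP : P = 0
  · rw [hP]; simp
  -- all four weights are non-zero ⇒ `|m| < 2M` ⇒ (`2M ∣ m` ↔ `m = 0` ↔ conservation)
  have hci : ∀ i : Fin 4, c (n i) ≠ 0 := by
    intro i hi
    apply hP
    rw [hPdef]
    exact mul_eq_zero_of_left (Finset.prod_eq_zero (Finset.mem_univ i) hi) _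
  have hb := fun i => hc (n i) (hci i)
  have habs : |m| < 2 * M := by
    have h0 := hb 0; have h1 := hb 1; have h2 := hb 2; have h3 := hb 3
    rw [abs_lt]
    constructor <;>
      nlinarith [le_abs_self (matsubaraInt M (n 0)), neg_abs_le (matsubaraInt M (n 0)), le_abs_self (matsubaraInt M (n 1)), neg_abs_le (matsubaraInt M (n 1)),
        le_abs_self (matsubaraInt M (n 2)), neg_abs_le (matsubaraInt M (n 2)), le_abs_self (matsubaraInt M (n 3)), neg_abs_le (matsubaraInt M (n 3))]
  have hdiv : (((2 * M : ℕ) : ℤ) ∣ m) ↔ m = 0 := by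
    constructor
    · rintro ⟨k, hk⟩
      rcases eq_or_ne k 0 with hk0 | hk0
      · rw [hk, hk0, mul_zero]
      · exfalso
        have h1 : (1 : ℤ) ≤ |k| := Int.one_le_abs hk0
        have h2 : |m| = ((2 * M : ℕ) : ℤ) * |k| := by rw [hk, abs_mul, abs_of_nonneg (by positivity)]
        have h3 : ((2 * M : ℕ) : ℤ) ≤ |m| := by rw [h2]; nlinarith
        push_cast at h3
        linarith
    · intro h; rw [h]; exact dvd_zero _
  have hcons : (matsubaraInt M (n 0) + matsubaraInt M (n 2) = matsubaraInt M (n 1) + matsubaraInt M (n 3)) ↔ m = 0 := by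
    rw [hmdef]; constructor <;> intro h <;> linarith
  by_cases hm : m = 0
  · rw [if_pos (hcons.mpr hm), if_pos (hdiv.mpr hm), ← mul_assoc, inv_mul_cancel₀ hN, one_mul]
  · rw [if_neg (fun h => hm (hcons.mp h)), if_neg (fun h => hm (hdiv.mp h)), zero_mul, mul_zero]

/-! ## §5 THE FACTORISATION BOUND `Θ ≤ A⁴` -/

/-- **ONE-LEG FACTORISATION BOUND** (E1 item (i), located #25 cure (α); HOME/hubbard-kl-k3c2-p2/g34/CUT-CURRENCY-DIGITS.md rev 2).
For `β ≠ 0`, any leg weight `c : ℤ_{2M} → ℂ` supported away from the Matsubara edge (`4|n'| < 2M` whenever `c(n) ≠ 0`), any pinned leg `q` and pin `y₀`: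
`(2M)⁻³ Σ_{t : t_q = y₀} |Σ_{n : n'₀+n'₂ = n'₁+n'₃} (∏_i c(n_i)) ∏_i e^{−is_iω_{n_i}τ_{t_i}}| ≤ A(c)⁴`, `A(c) = (2M)⁻¹Σ_{j}|Σ_v c(v)e^{−2πivj/(2M)}|`. -/
theorem klct_pinnedTimeSum_le_legMass_pow_four {β : ℝ} (hβ : β ≠ 0) (c : MatsubaraIdx M → ℂ)
    (hc : ∀ n : MatsubaraIdx M, c n ≠ 0 → (4 : ℤ) * |matsubaraInt M n| < 2 * M) (q : Fin 4) (y₀ : ImagTimeIdx M) :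
    (((2 * M : ℕ) : ℝ) ^ 3)⁻¹ *
        ∑ t ∈ univ.filter (fun t : Fin 4 → ImagTimeIdx M => t q = y₀),
          ‖∑ n : Fin 4 → MatsubaraIdx M,
              if matsubaraInt M (n 0) + matsubaraInt M (n 2) = matsubaraInt M (n 1) + matsubaraInt M (n 3) then
                (∏ i : Fin 4, c (n i)) * ∏ i : Fin 4, Complex.exp (-((chargeSign ((![(((0 : Fin 1), (0 : Fin 2)), (0 : Fin 2)), ((0, 0), 1), ((0, 1), 0), ((0, 1), 1)] : Fin 4 → SectorLeg 1) i).2 * (matsubaraFreq β M (n i) * imagTime β M (t i)) : ℝ) : ℂ) * Complex.I)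
              else 0‖ ≤
      ((((2 * M : ℕ) : ℝ))⁻¹ * ∑ j : ImagTimeIdx M, ‖∑ n : MatsubaraIdx M, c n * Complex.exp (-((2 * Real.pi * ((n : ℕ) : ℝ) * ((j : ℕ) : ℝ) / (2 * M) : ℝ) : ℂ) * Complex.I)‖) ^ 4 := by
  have hN0 : 0 < ((2 * M : ℕ) : ℝ) := by have := NeZero.ne M; exact_mod_cast (by omega : 0 < 2 * M)
  -- the leg factor and its modulus
  set G : Fin 4 → ImagTimeIdx M → ImagTimeIdx M → ℂ := fun i u σ =>
      ∑ v : MatsubaraIdx M, c v * Complex.exp (-((chargeSign (![(0 : Fin 2), 1, 0, 1] i) * (matsubaraFreq β M v * imagTime β M u) : ℝ) : ℂ) * Complex.I) *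
        Complex.exp (-((2 * Real.pi * chargeSign (![(0 : Fin 2), 1, 0, 1] i) * (matsubaraInt M v : ℝ) * ((σ : ℕ) : ℝ) / (2 * M) : ℝ) : ℂ) * Complex.I) with hGdef
  set Mass : ℝ := ∑ j : ImagTimeIdx M, ‖∑ n : MatsubaraIdx M, c n * Complex.exp (-((2 * Real.pi * ((n : ℕ) : ℝ) * ((j : ℕ) : ℝ) / (2 * M) : ℝ) : ℂ) * Complex.I)‖
    with hMassdef
  have hMass0 : 0 ≤ Mass := Finset.sum_nonneg (fun _ _ => norm_nonneg _)
  -- leg sums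
  have hlegT : ∀ (i : Fin 4) (σ : ImagTimeIdx M), ∑ u : ImagTimeIdx M, ‖G i u σ‖ = Mass := fun i σ => klct_sum_leg_norm_time hβ c _ σ
  have hlegA : ∀ (i : Fin 4) (u : ImagTimeIdx M), ∑ σ : ImagTimeIdx M, ‖G i u σ‖ = Mass := fun i u => klct_sum_leg_norm_aux hβ c _ u
  -- pointwise bound at each `t`
  have hpt : ∀ t : Fin 4 → ImagTimeIdx M,
      ‖∑ n : Fin 4 → MatsubaraIdx M,
          if matsubaraInt M (n 0) + matsubaraInt M (n 2) = matsubaraInt M (n 1) + matsubaraInt M (n 3) then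
            (∏ i : Fin 4, c (n i)) * ∏ i : Fin 4, Complex.exp (-((chargeSign ((![(((0 : Fin 1), (0 : Fin 2)), (0 : Fin 2)), ((0, 0), 1), ((0, 1), 0), ((0, 1), 1)] : Fin 4 → SectorLeg 1) i).2 * (matsubaraFreq β M (n i) * imagTime β M (t i)) : ℝ) : ℂ) * Complex.I)
          else 0‖ ≤ (((2 * M : ℕ) : ℝ))⁻¹ * ∑ σ : ImagTimeIdx M, ∏ i : Fin 4, ‖G i (t i) σ‖ := by
    intro t
    rw [klct_timeSum_eq_aux_sum β c hc t, norm_mul, norm_inv, Complex.norm_natCast]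
    gcongr
    refine (norm_sum_le _ _).trans (le_of_eq ?_)
    refine Finset.sum_congr rfl (fun σ _ => ?_)
    rw [norm_prod]
  -- sum over the pinned tuples
  have hsum : ∑ t ∈ univ.filter (fun t : Fin 4 → ImagTimeIdx M => t q = y₀), (((2 * M : ℕ) : ℝ))⁻¹ * ∑ σ : ImagTimeIdx M, ∏ i : Fin 4, ‖G i (t i) σ‖ =
      (((2 * M : ℕ) : ℝ))⁻¹ * Mass ^ 4 := by
    rw [← Finset.mul_sum, Finset.sum_comm]
    congr 1
    have hinner : ∀ σ : ImagTimeIdx M, ∑ t ∈ univ.filter (fun t : Fin 4 → ImagTimeIdx M => t q = y₀), ∏ i : Fin 4, ‖G i (t i) σ‖ = ‖G q y₀ σ‖ * Mass ^ 3 := by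
      intro σ
      rw [klct_sum_pinned_prod (fun i u => ‖G i u σ‖) q y₀]
      congr 1
      rw [Finset.prod_congr rfl (fun i _ => hlegT i σ), Finset.prod_const, Finset.card_erase_of_mem (Finset.mem_univ q)]
      simp
    simp_rw [hinner]
    rw [← Finset.sum_mul, hlegA q y₀]
    ring
  calc _ ≤ (((2 * M : ℕ) : ℝ) ^ 3)⁻¹ * ∑ t ∈ univ.filter (fun t : Fin 4 → ImagTimeIdx M => t q = y₀), (((2 * M : ℕ) : ℝ))⁻¹ * ∑ σ : ImagTimeIdx M, ∏ i : Fin 4, ‖G i (t i) σ‖ := by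
        gcongr with t ht
        exact hpt t
    _ = _ := by rw [hsum]; field_simp

/-! ## §6 Corollary: the UV-cut bare vertex -/

omit [NeZero M] in
/-- On the cut's support the Matsubara integer is far from the edge: `ĝ(ω_n) ≠ 0 ⇒ 4|n'| < 2M` once `2 ≤ β ≤ M`
(`ĝ(ω) = 0` for `|ω| ≥ 4·klE0 = 1/8`, so `|2n'+1| < β/(8π)`). -/
theorem klct_uvCut_support {β : ℝ} (hβ : 2 ≤ β) (hM : β ≤ M) (n : MatsubaraIdx M)
    (hn : (((gnScaleCutoff 4 klE0 1 |matsubaraFreq β M n| : ℝ) : ℂ)) ≠ 0) : (4 : ℤ) * |matsubaraInt M n| < 2 * M := by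
  have hβ0 : 0 < β := by linarith
  -- off the support the cutoff vanishes
  have hlt : |matsubaraFreq β M n| < 4 * klE0 := by
    by_contra hge
    push Not at hge
    apply hn
    have h0 : gnScaleCutoff 4 klE0 1 |matsubaraFreq β M n| = 0 := by
      rw [gnScaleCutoff]
      apply gnCutoff_eq_zero (by norm_num) (by norm_num [klE0])
      rw [zpow_neg, zpow_one]
      linarith
    rw [h0]; simp
  -- `|π(2n'+1)/β| < 1/8` ⇒ `π|2n'+1| < β/8` ⇒ `4|n'| < 2M`
  have hk : klE0 = 1 / 32 := rfl
  rw [hk, matsubaraFreq, abs_div, abs_of_pos hβ0, div_lt_iff₀ hβ0, abs_mul, abs_of_pos Real.pi_pos] at hlt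
  have hpi := Real.pi_gt_three
  have h1 : |(2 * (matsubaraInt M n : ℝ) + 1)| < β / 24 := by nlinarith [abs_nonneg (2 * (matsubaraInt M n : ℝ) + 1)]
  have h2 : (4 : ℝ) * |(matsubaraInt M n : ℝ)| < 2 * M := by
    have : |(matsubaraInt M n : ℝ)| ≤ (|(2 * (matsubaraInt M n : ℝ) + 1)| + 1) / 2 := by
      rw [abs_le]; constructor <;> nlinarith [le_abs_self (2 * (matsubaraInt M n : ℝ) + 1), neg_abs_le (2 * (matsubaraInt M n : ℝ) + 1)]
    nlinarith
  exact_mod_cast h2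

/-- **THE PLAIN PINNED CURRENCY OF THE UV-CUT BARE VERTEX IS AT MOST `(|U|/24)·A(ĝ∘ω)⁴`** (`2 ≤ β ≤ M`):
`ε_x³ Σ_{x′ : x′_q = y}‖W₄(S_ĝ V)(x′)‖ ≤ (|U|/24)·((2M)⁻¹Σ_j|Σ_v ĝ(ω_v)e^{−2πivj/(2M)}|)⁴` — ✓ p773994's identity followed by `klct_pinnedTimeSum_le_legMass_pow_four`. -/
theorem klbv_plainCurrency_uvCut_hubbardInteraction_le_legMass_pow_four [NeZero L] {β : ℝ} (hβ : 2 ≤ β) (hM : β ≤ M) (U : ℝ) (q : Fin 4) (y : SpaceTimeIdx L M) :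
    imagTimeWeight β M ^ 3 *
        ∑ x ∈ univ.filter (fun x : Fin 4 → SpaceTimeIdx L M => x q = y),
          ‖sectorisedKernel L M β (trivialMultiplier L M)
            (ExteriorAlgebra.map (LinearMap.mulLeft ℂ (fun K : HubbardFieldIdx L M => ((gnScaleCutoff 4 klE0 1 |matsubaraFreq β M K.1.1.1| : ℝ) : ℂ))) (hubbardInteraction L M β U)) 4
            (![(((0 : Fin 1), (0 : Fin 2)), (0 : Fin 2)), ((0, 0), 1), ((0, 1), 0), ((0, 1), 1)] : Fin 4 → SectorLeg 1) x‖ ≤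
      |U| / 24 * ((((2 * M : ℕ) : ℝ))⁻¹ * ∑ j : ImagTimeIdx M, ‖∑ n : MatsubaraIdx M, (((gnScaleCutoff 4 klE0 1 |matsubaraFreq β M n| : ℝ) : ℂ)) *
          Complex.exp (-((2 * Real.pi * ((n : ℕ) : ℝ) * ((j : ℕ) : ℝ) / (2 * M) : ℝ) : ℂ) * Complex.I)‖) ^ 4 := by
  have hβ0 : 0 < β := by linarith
  rw [klbv_plainCurrency_uvCut_hubbardInteraction_eq hβ0 U q y]
  gcongr
  exact klct_pinnedTimeSum_le_legMass_pow_four hβ0.ne' _ (fun n hn => klct_uvCut_support hβ hM n hn) q y.1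

end Summit.HubbardSuperconductivity.HubbardSuperconductivity.Theorems.KLRegimeSplit

end
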